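import Summits.ABC.IUTFork.Cor312LicenceShallowReal
import Summits.ABC.IUTFork.Thm311RealIsmDHOrbitSpan
import HarnessLib

/-!
# [IUTchIII] Cor. 3.12 — the (xi-f) LICENCE and branch C's hull-level antecedent are INHABITED at the sharp real
# settings in the TAME SHALLOW window (`p > 2`, `e_v ≤ p − 2`, `t_Θ` in ONE `p`-level of the log-shell lattice above `t_q`)

PROOF-ONLY record file (D-0012; 0 definitions, 0 `Prop` facts) of the abc-iut cell (WAVE-5 prover seat abc-iut-w5-d236,
gen 8; row «LICENCE-SHALLOW-RAMIFIED-KERNEL» part (B)). TAKES NO SIDE on [IUTchIII] Cor. 3.12 or on any author.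
Companion of `Cor312LicenceShallowReal` (the ASSEMBLY: Licence from one-factor (Ind2)-movers): here the movers are
SUPPLIED at tame places from campaign-S / Team-R lattice algebra, kernelizing the positive half of abc-iut-c312-3's
MATH NOTE (HOME/STATUS 2026-08-26T08:51:10Z; plan ruling C-R18 case (C)/(B-shallow) «not decided»):

* §1 `exists_mem_ismDH_apply_eq_of_tame` — at a place `v | p`, `p > 2`, `e(v|p) ≤ p − 2`, analytic logarithm
  (`log_p(𝒪_v^×) = 𝔪_v`, abc-iut-w5-d180 `logUnits_eq_closedBall_of_tame`), Dupuy–Hilado's (Ind2) group `Real.ismDH` is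
  TRANSITIVE on each `p`-LEVEL `{‖p‖^{k+1}·‖ϖ‖ < ‖y‖ ≤ ‖p‖^k·‖ϖ‖} = p^k·𝔪_v ∖ p^{k+1}·𝔪_v` of the lattice `𝔪_v = p·I_v`
  (w5-d180 `exists_mem_ismDH_apply_eq_of_primitive`: lattice automorphisms are transitive on primitive vectors, Weil *BNT*
  II §2 Th. 1); `exists_mem_ismDH_norm_apply_eq_of_tame`: a `t` in the level `k` is moved onto an element of norm
  `‖p‖^k·‖ϖ‖` (the top of the level, e.g. `p^k·ϖ`), so `exists_mover_of_tame`: the MOVER hypothesis of the companion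
  holds at `v` as soon as `‖t_q‖ ≤ ‖p‖^k·‖ϖ‖`;
* §2 **`licence_settingDHVolSharp_of_tame_levels`** / **`licence_settingPrVolSharp_of_tame_levels`** — the (xi-f) licence
  at abc-iut-c312-3's / c312-7's sharp real settings whenever at every `(p, j, x)` EITHER `‖t_{q,x}‖ ≤ ‖t_{Θ,j,x}‖` (e.g. off
  `S`) OR `x` is tame and `t_{Θ,j,x}` lies in a `p`-level `k` of `𝔪_x` with `‖t_{q,x}‖ ≤ ‖p‖^k·‖ϖ_x‖`; and
  **`exists_qPinned_and_hull_settingPrVolSharp_of_tame_levels`** — branch C's «∃ ρ qK, QPinned ∧ PilotKummerCompatHull»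
  there (any columns), for integral `t_q` (label `0`);
* §3 **`licence_settingDHVolSharp_of_shallow`** — c312-3's window (`k = 0`): every bad place tame, Θ-ideles units off
  `S`, and at the bad places `‖p‖·‖ϖ_x‖ < ‖t_{Θ,j,x}‖ ≤ ‖ϖ_x‖ ⊇`-wise `‖t_{q,x}‖ ≤ ‖ϖ_x‖` — in orders: `1 ≤ ord_x(t_{Θ,j}) ≤ e_x`
  and `ord_x(t_q) ≥ 1`; for ideles realising `P_Θ = j²·P_q` this is `j²·ord_x(t_q) ≤ e_x`, i.e. SHALLOW and RAMIFIED
  (`e_x ≥ j² ≥ 1`; at `e_x = 1` only `j = 1` with `ord(t_q) = 1`).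

So in OUR typed objects the hull-level licence at genuine-signature data is decided by DEPTH at tame places: REFUTED at
deep packets (abc-iut-w4-d026 `not_licence_settingPrVolSharp_of_deep`, C-cert-2 `…_of_deep_unramified`), INHABITED in the
tame shallow window (this file). HONEST SCOPE: statements about OUR sharp containers (Θ-regions constant in `m`) and
Dupuy–Hilado's typed (Ind2) = lattice isomorphisms of `I_v`; the licence is a STRONGER-THAN-PRINT form (ADJUDICATION-SPEC
§2 (G1′)); where it holds, C-cert-1's `thetaSide_of_exists_qPinned_and_hull_settingPrVolSharp` yields the typed Θ-side
inequality at that setting; nothing here bears on the printed GLOBAL inequality, and nothing asserts or refutes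
[IUTchIII] Cor. 3.12. [cite: DupuyHilado2025, §3.9, §4.9] [cite: WeilBNT1967, Ch. II §2, Th. 1–2]
[cite: NeukirchANT1999, Ch. II Prop. (5.5)] [claim: Mochizuki2012, status: disputed] for every IUT sentence quoted.
typed ≠ proved; instantiated ≠ endorsed.
-/

noncomputable section

open Set Metric Function NumberField IsDedekindDomain
open scoped Pointwise

namespace Summit.ABC.IUTFork.Thm311.Real

open Cor312 Cor312.Setting Cor312Vol Literature.IUT.LogThetaLattice Literature.IUT.LogVolume
open Literature.NumberTheory.NumberFields Literature.NumberTheory.GaloisRepresentations.Ultrametric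

/-! ## 1. One factor: (Ind2) is transitive on each `p`-level of `𝔪_v` at a tame place -/

section OneFactor

variable {F : Type} [Field F] [NumberField F] {p : ℕ} [hp : Fact p.Prime]
variable {logv : PadicLogs F} (hlog : LogvAnalyticAt p logv)
variable (v : HeightOneSpectrum (𝓞 F)) (hv : ((p : ℕ) : 𝓞 F) ∈ v.asIdeal)

/-- `p^k·𝔪_v` is the ball of radius `‖p‖^k·‖ϖ‖`. [cite: NeukirchANT1999, Ch. II Prop. (5.5)] -/
theorem zpow_smul_closedBall_eq (k : ℤ) (r : ℝ) :
    ((p : ℚ_[p]) ^ k) • closedBall (0 : RescaledCompletion F p v hv) r =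
      closedBall 0 (‖(p : ℚ_[p])‖ ^ k * r) := by
  have hc : ((p : ℚ_[p]) ^ k) ≠ 0 := zpow_ne_zero _ (Nat.cast_ne_zero.mpr hp.out.ne_zero)
  rw [smul_closedBall' hc, smul_zero, norm_zpow]

include hlog in
/-- **(Ind2) is TRANSITIVE on each `p`-level of `𝔪_v` at a tame place**: for `p > 2`, `e(v|p) ≤ p − 2`, a uniformizer `ϖ`,
`k ∈ ℤ`, and `t, y` with `‖p‖·(‖p‖^k·‖ϖ‖) < ‖t‖, ‖y‖ ≤ ‖p‖^k·‖ϖ‖` (both primitive in the lattice `p^k·𝔪_v =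
p^k·log_p(𝒪_v^×)`), some `g ∈ Real.ismDH logv (inr v)` maps `t` to `y`. [cite: WeilBNT1967, Ch. II §2, Th. 1]
[cite: DupuyHilado2025, §4.9] [cite: NeukirchANT1999, Ch. II Prop. (5.5)] -/
theorem exists_mem_ismDH_apply_eq_of_tame (hp2 : 2 < p) (he : v.asIdeal.ramificationIdx ℤ ≤ p - 2)
    {ϖ : (RescaledCompletion F p v hv)ˣ} (hϖ : IsUniformizer ϖ) (k : ℤ) {t y : RescaledCompletion F p v hv}
    (ht1 : ‖(p : ℚ_[p])‖ * (‖(p : ℚ_[p])‖ ^ k * ‖(ϖ : RescaledCompletion F p v hv)‖) < ‖t‖)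
    (ht2 : ‖t‖ ≤ ‖(p : ℚ_[p])‖ ^ k * ‖(ϖ : RescaledCompletion F p v hv)‖)
    (hy1 : ‖(p : ℚ_[p])‖ * (‖(p : ℚ_[p])‖ ^ k * ‖(ϖ : RescaledCompletion F p v hv)‖) < ‖y‖)
    (hy2 : ‖y‖ ≤ ‖(p : ℚ_[p])‖ ^ k * ‖(ϖ : RescaledCompletion F p v hv)‖) :
    ∃ g ∈ ismDH logv (.inr v), toR p v hv (g (ofR p v hv t)) = y := by
  have hΛ := logUnits_eq_closedBall_of_tame (F := F) (v := v) (hv := hv) hp2 he hϖ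
  have hlev : ((p : ℚ_[p]) ^ k) • (logUnits (RescaledCompletion F p v hv) : Set (RescaledCompletion F p v hv)) =
      closedBall 0 (‖(p : ℚ_[p])‖ ^ k * ‖(ϖ : RescaledCompletion F p v hv)‖) := by
    rw [hΛ, zpow_smul_closedBall_eq]
  have hlev' : ((p : ℚ_[p]) * (p : ℚ_[p]) ^ k) • (logUnits (RescaledCompletion F p v hv) : Set (RescaledCompletion F p v hv)) =
      closedBall 0 (‖(p : ℚ_[p])‖ * (‖(p : ℚ_[p])‖ ^ k * ‖(ϖ : RescaledCompletion F p v hv)‖)) := by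
    rw [mul_smul, hlev, smul_closedBall' (Nat.cast_ne_zero.mpr hp.out.ne_zero), smul_zero]
  refine exists_mem_ismDH_apply_eq_of_primitive hlog v hv (c := (p : ℚ_[p]) ^ k) ?_ ?_ ?_ ?_
  · rw [hlev]; exact mem_closedBall_zero_iff.2 ht2
  · rw [hlev']; exact fun h => (mem_closedBall_zero_iff.1 h).not_gt ht1
  · rw [hlev]; exact mem_closedBall_zero_iff.2 hy2
  · rw [hlev']; exact fun h => (mem_closedBall_zero_iff.1 h).not_gt hy1

include hlog in
/-- **Mover to the top of the level**: a `t` in the `p`-level `k` of `𝔪_v` is carried by some (Ind2)-element onto an element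
of norm EXACTLY `‖p‖^k·‖ϖ‖` (e.g. `p^k·ϖ`). [cite: WeilBNT1967, Ch. II §2, Th. 1] [cite: DupuyHilado2025, §4.9] -/
theorem exists_mem_ismDH_norm_apply_eq_of_tame (hp2 : 2 < p) (he : v.asIdeal.ramificationIdx ℤ ≤ p - 2)
    {ϖ : (RescaledCompletion F p v hv)ˣ} (hϖ : IsUniformizer ϖ) (k : ℤ) {t : RescaledCompletion F p v hv}
    (ht1 : ‖(p : ℚ_[p])‖ * (‖(p : ℚ_[p])‖ ^ k * ‖(ϖ : RescaledCompletion F p v hv)‖) < ‖t‖)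
    (ht2 : ‖t‖ ≤ ‖(p : ℚ_[p])‖ ^ k * ‖(ϖ : RescaledCompletion F p v hv)‖) :
    ∃ g ∈ ismDH logv (.inr v),
      ‖toR p v hv (g (ofR p v hv t))‖ = ‖(p : ℚ_[p])‖ ^ k * ‖(ϖ : RescaledCompletion F p v hv)‖ := by
  have hy : ‖((p : ℚ_[p]) ^ k) • (ϖ : RescaledCompletion F p v hv)‖ =
      ‖(p : ℚ_[p])‖ ^ k * ‖(ϖ : RescaledCompletion F p v hv)‖ := by rw [norm_smul, norm_zpow]
  have hpos : 0 < ‖(p : ℚ_[p])‖ ^ k * ‖(ϖ : RescaledCompletion F p v hv)‖ :=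
    mul_pos (zpow_pos (norm_pos_iff.2 (Nat.cast_ne_zero.mpr hp.out.ne_zero)) k) (norm_pos_iff.2 ϖ.ne_zero)
  obtain ⟨g, hg, hgt⟩ := exists_mem_ismDH_apply_eq_of_tame hlog v hv hp2 he hϖ k ht1 ht2
    (y := ((p : ℚ_[p]) ^ k) • (ϖ : RescaledCompletion F p v hv))
    (by rw [hy]; exact mul_lt_of_lt_one_left hpos Padic.norm_p_lt_one) hy.le
  exact ⟨g, hg, by rw [hgt, hy]⟩

include hlog in
/-- **The MOVER HYPOTHESIS at a tame place**: if `t` lies in the `p`-level `k` of `𝔪_v` and `‖t_q‖ ≤ ‖p‖^k·‖ϖ‖`, some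
(Ind2)-element `g` has `‖t_q‖ ≤ ‖g(t)‖`. [cite: WeilBNT1967, Ch. II §2, Th. 1] [cite: DupuyHilado2025, §4.9] -/
theorem exists_mover_of_tame (hp2 : 2 < p) (he : v.asIdeal.ramificationIdx ℤ ≤ p - 2)
    {ϖ : (RescaledCompletion F p v hv)ˣ} (hϖ : IsUniformizer ϖ) (k : ℤ) {t tq : RescaledCompletion F p v hv}
    (ht1 : ‖(p : ℚ_[p])‖ * (‖(p : ℚ_[p])‖ ^ k * ‖(ϖ : RescaledCompletion F p v hv)‖) < ‖t‖)
    (ht2 : ‖t‖ ≤ ‖(p : ℚ_[p])‖ ^ k * ‖(ϖ : RescaledCompletion F p v hv)‖)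
    (htq : ‖tq‖ ≤ ‖(p : ℚ_[p])‖ ^ k * ‖(ϖ : RescaledCompletion F p v hv)‖) :
    ∃ g ∈ ismDH logv (.inr v), ‖tq‖ ≤ ‖toR p v hv (g (ofR p v hv t))‖ := by
  obtain ⟨g, hg, hgt⟩ := exists_mem_ismDH_norm_apply_eq_of_tame hlog v hv hp2 he hϖ k ht1 ht2
  exact ⟨g, hg, by rw [hgt]; exact htq⟩

end OneFactor

/-! ## 2. The sharp real settings: the licence in the tame-levels regime -/

section Setting

variable {F : Type} [Field F] [NumberField F] (X : PilotData F) {logv : PadicLogs F} (hlog : LogvAnalytic logv)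
  (M : Type) [Field M] [NumberField M]
  (archPk : ∀ (j : (thetaIndex X).Label) (vQ : (thetaIndex X).VQ), Set ((logShellsDH X logv).Packet j vQ))
  (archSub : ∀ (j : (thetaIndex X).Label) (v : (thetaIndex X).V),
    Set ((logShellsDH X logv).Packet j ((thetaIndex X).over v)))
  (Ψ : ℤ → ∀ v : (thetaIndex X).V, v ∈ (thetaIndex X).Vbad → Set ((logShellsDH X logv).StarPacket v))
  (act : ℤ → ∀ v : (thetaIndex X).V, v ∈ (thetaIndex X).Vbad →
    (logShellsDH X logv).StarPacket v → Module.End ℚ ((logShellsDH X logv).StarPacket v))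
  (Mmod : ℤ → ∀ j : (thetaIndex X).LabelStar, Set ((logShellsDH X logv).GlobalPacket j.1))
  (region : ℤ → ∀ j : (thetaIndex X).LabelStar, FinDivisor M → ∀ vQ : (thetaIndex X).VQ,
    Set ((logShellsDH X logv).Packet j.1 vQ))
  (n : ℤ) {HT : Type} {LogLink : HT → HT → Type} {IsFull : ∀ {s t : HT}, LogLink s t → Prop}
  (lat : LGPGaussianLogThetaLattice LogLink IsFull)
  {Frd : Type} {IsoF : Frd → Frd → Type} {Ob : Frd → Type} {realify : Frd → Frd} {Strip : Type}
  {IsoS : Strip → Strip → Type} {Mv : ∀ v : (thetaIndex X).V, v ∈ (thetaIndex X).Vbad → Type}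
  [∀ v h, Monoid (Mv v h)]
  (sig : GlobalLGPFrobenioidSignature (thetaIndex X).lstar (thetaIndex X).V (· ∈ (thetaIndex X).Vbad)
    Frd IsoF Ob realify Strip IsoS Mv)
  (split : SplittingMonoids Mv) {ObΔ : Type} {N : ∀ v : (thetaIndex X).V, v ∈ (thetaIndex X).Vbad → Type}
  [∀ v h, Monoid (N v h)] (qData : QPilotData ObΔ N)
  (tq : ∀ (pp : Nat.Primes) (x : (thetaIndex X).Fibre (.inr pp)), haveI : Fact (pp : ℕ).Prime := ⟨pp.2⟩; kOf X pp.1 x)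
  (t : ∀ (pp : Nat.Primes) (_ : Fin X.lstar) (x : (thetaIndex X).Fibre (.inr pp)),
    haveI : Fact (pp : ℕ).Prime := ⟨pp.2⟩; kOf X pp.1 x)
  (htq0 : ∀ pp x, tq pp x ≠ 0)
  (htq1 : ∀ (pp : Nat.Primes) (x : (thetaIndex X).Fibre (.inr pp)),
    haveI : Fact (pp : ℕ).Prime := ⟨pp.2⟩; placeOf X pp.1 x ∉ X.S → ‖tq pp x‖ = 1)
  (col : ℤ → Column (logShellsDH X logv))

/-- **The mover hypothesis at a fibre point from the TAME-LEVEL ALTERNATIVE**: at `(p, j, x)`, EITHER `‖t_{q,x}‖ ≤ ‖t_{Θ,j,x}‖`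
OR `x` is tame (`p > 2`, `e_x ≤ p − 2`) and `t_{Θ,j,x}` lies in a `p`-level `k` of `𝔪_x` with `‖t_{q,x}‖ ≤ ‖p‖^k·‖ϖ_x‖` — then
some `g ∈ Real.ismDH logv x` has `‖t_{q,x}‖ ≤ ‖g(t_{Θ,j,x})‖`. [cite: WeilBNT1967, Ch. II §2, Th. 1] [cite: DupuyHilado2025, §4.9] -/
theorem exists_mover_of_tame_level (pp : Nat.Primes) (j : (thetaIndex X).Label) (x : (thetaIndex X).Fibre (.inr pp))
    (h : haveI : Fact (pp : ℕ).Prime := ⟨pp.2⟩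
      ‖tq pp x‖ ≤ ‖labelIdele X t pp j x‖ ∨
        (2 < (pp : ℕ) ∧ (placeOf X pp.1 x).asIdeal.ramificationIdx ℤ ≤ (pp : ℕ) - 2 ∧
          ∃ (ϖ : (kOf X pp.1 x)ˣ) (k : ℤ), IsUniformizer ϖ ∧
            ‖(pp : ℚ_[pp])‖ * (‖(pp : ℚ_[pp])‖ ^ k * ‖(ϖ : kOf X pp.1 x)‖) < ‖labelIdele X t pp j x‖ ∧
            ‖labelIdele X t pp j x‖ ≤ ‖(pp : ℚ_[pp])‖ ^ k * ‖(ϖ : kOf X pp.1 x)‖ ∧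
            ‖tq pp x‖ ≤ ‖(pp : ℚ_[pp])‖ ^ k * ‖(ϖ : kOf X pp.1 x)‖)) :
    haveI : Fact (pp : ℕ).Prime := ⟨pp.2⟩
    ∃ g ∈ ismDH logv x.1,
      ‖tq pp x‖ ≤ ‖(presAt X hlog pp).φ x (g (((presAt X hlog pp).φ x).symm (labelIdele X t pp j x)))‖ := by
  haveI : Fact (pp : ℕ).Prime := ⟨pp.2⟩
  rcases h with h | ⟨hp2, he, ϖ, k, hϖ, h1, h2, h3⟩
  · exact exists_mover_of_norm_le X hlog tq t pp j x h
  · obtain ⟨x1, hx⟩ := x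
    rcases x1 with w | v
    · exact absurd hx (by simp [thetaIndex])
    · obtain ⟨g, hg, hgn⟩ := exists_mover_of_tame (hlog pp) v (natCast_mem_placeOf X pp.1 ⟨.inr v, hx⟩) hp2 he hϖ k h1 h2 h3
      exact ⟨g, hg, hgn⟩

/-- **THE (xi-f) LICENCE AT `settingDHVolSharp` IN THE TAME-LEVELS REGIME**: if at every prime `p`, label `j = i+1 ∈ 𝔽_l^⋇` and
place `x | p` either `‖t_{q,x}‖ ≤ ‖t_{Θ,j,x}‖` (e.g. `x ∉ S`: both units) or `x` is tame and `t_{Θ,j,x}` lies in a `p`-level `k` of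
`𝔪_x` with `‖t_{q,x}‖ ≤ ‖p‖^k·‖ϖ_x‖`, then the q-pilot region lies in `ⁿ˒°𝒰_{j,v_ℚ}` at every `(j, v_ℚ)`, `j ∈ 𝔽_l^⋇`.
[cite: DupuyHilado2025, §3.9, §4.9] [cite: WeilBNT1967, Ch. II §2, Th. 1] [claim: Mochizuki2012, status: disputed] -/
theorem licence_settingDHVolSharp_of_tame_levels
    (h : ∀ (pp : Nat.Primes) (i : Fin (thetaIndex X).lstar) (x : (thetaIndex X).Fibre (.inr pp)),
      haveI : Fact (pp : ℕ).Prime := ⟨pp.2⟩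
      ‖tq pp x‖ ≤ ‖t pp i x‖ ∨
        (2 < (pp : ℕ) ∧ (placeOf X pp.1 x).asIdeal.ramificationIdx ℤ ≤ (pp : ℕ) - 2 ∧
          ∃ (ϖ : (kOf X pp.1 x)ˣ) (k : ℤ), IsUniformizer ϖ ∧
            ‖(pp : ℚ_[pp])‖ * (‖(pp : ℚ_[pp])‖ ^ k * ‖(ϖ : kOf X pp.1 x)‖) < ‖t pp i x‖ ∧
            ‖t pp i x‖ ≤ ‖(pp : ℚ_[pp])‖ ^ k * ‖(ϖ : kOf X pp.1 x)‖ ∧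
            ‖tq pp x‖ ≤ ‖(pp : ℚ_[pp])‖ ^ k * ‖(ϖ : kOf X pp.1 x)‖)) :
    Thm311ToCor312.Licence (settingDHVolSharp X hlog M archPk archSub Ψ act Mmod region n lat sig split qData tq t htq0 htq1) := by
  refine licence_settingDHVolSharp_of_movers X hlog M archPk archSub Ψ act Mmod region n lat sig split qData tq t htq0 htq1
    fun pp i x => ?_
  have hm := exists_mover_of_tame_level X hlog tq t pp (labelSucc i) x (by rw [labelIdele_labelSucc]; exact h pp i x)
  rw [labelIdele_labelSucc] at hm
  exact hm

/-- **The same at the print-normalised sharp setting `settingPrVolSharp`.** [claim: Mochizuki2012, status: disputed] -/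
theorem licence_settingPrVolSharp_of_tame_levels
    (h : ∀ (pp : Nat.Primes) (i : Fin (thetaIndex X).lstar) (x : (thetaIndex X).Fibre (.inr pp)),
      haveI : Fact (pp : ℕ).Prime := ⟨pp.2⟩
      ‖tq pp x‖ ≤ ‖t pp i x‖ ∨
        (2 < (pp : ℕ) ∧ (placeOf X pp.1 x).asIdeal.ramificationIdx ℤ ≤ (pp : ℕ) - 2 ∧
          ∃ (ϖ : (kOf X pp.1 x)ˣ) (k : ℤ), IsUniformizer ϖ ∧
            ‖(pp : ℚ_[pp])‖ * (‖(pp : ℚ_[pp])‖ ^ k * ‖(ϖ : kOf X pp.1 x)‖) < ‖t pp i x‖ ∧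
            ‖t pp i x‖ ≤ ‖(pp : ℚ_[pp])‖ ^ k * ‖(ϖ : kOf X pp.1 x)‖ ∧
            ‖tq pp x‖ ≤ ‖(pp : ℚ_[pp])‖ ^ k * ‖(ϖ : kOf X pp.1 x)‖)) :
    Thm311ToCor312.Licence (settingPrVolSharp X hlog M archPk archSub Ψ act Mmod region n lat sig split qData tq t htq0 htq1) := by
  rw [licence_settingPrVolSharp_iff_settingDHVolSharp]
  exact licence_settingDHVolSharp_of_tame_levels X hlog M archPk archSub Ψ act Mmod region n lat sig split qData tq t htq0 htq1 h

/-- **BRANCH C's HULL-LEVEL ANTECEDENT «∃ ρ qK, QPinned ∧ PilotKummerCompatHull» IS INHABITED at `settingPrVolSharp` in the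
tame-levels regime** (any columns), for q-ideles that are INTEGRAL (`‖t_{q,x}‖ ≤ 1`: the label `0`, where the Θ-idele is `1`).
[cite: DupuyHilado2025, §3.9, §4.9] [cite: WeilBNT1967, Ch. II §2, Th. 1] [claim: Mochizuki2012, status: disputed] -/
theorem exists_qPinned_and_hull_settingPrVolSharp_of_tame_levels (htqle : ∀ pp x, ‖tq pp x‖ ≤ 1)
    (h : ∀ (pp : Nat.Primes) (i : Fin (thetaIndex X).lstar) (x : (thetaIndex X).Fibre (.inr pp)),
      haveI : Fact (pp : ℕ).Prime := ⟨pp.2⟩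
      ‖tq pp x‖ ≤ ‖t pp i x‖ ∨
        (2 < (pp : ℕ) ∧ (placeOf X pp.1 x).asIdeal.ramificationIdx ℤ ≤ (pp : ℕ) - 2 ∧
          ∃ (ϖ : (kOf X pp.1 x)ˣ) (k : ℤ), IsUniformizer ϖ ∧
            ‖(pp : ℚ_[pp])‖ * (‖(pp : ℚ_[pp])‖ ^ k * ‖(ϖ : kOf X pp.1 x)‖) < ‖t pp i x‖ ∧
            ‖t pp i x‖ ≤ ‖(pp : ℚ_[pp])‖ ^ k * ‖(ϖ : kOf X pp.1 x)‖ ∧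
            ‖tq pp x‖ ≤ ‖(pp : ℚ_[pp])‖ ^ k * ‖(ϖ : kOf X pp.1 x)‖)) :
    ∃ (ρ : (∀ v : (thetaIndex X).V, v ∈ (thetaIndex X).Vbad → Set ((logShellsDH X logv).StarPacket v)) →
          ∀ (j : (thetaIndex X).Label) (vQ : (thetaIndex X).VQ), Set ((logShellsDH X logv).Packet j vQ))
        (qK : ∀ v : (thetaIndex X).V, v ∈ (thetaIndex X).Vbad → Set ((logShellsDH X logv).StarPacket v)),
        QPinned ({ toSituation := situationPrVol X hlog M archPk archSub Ψ act Mmod region, col := col } :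
            LatticeSituation (thetaIndex X))
          (settingPrVolSharp X hlog M archPk archSub Ψ act Mmod region n lat sig split qData tq t htq0 htq1) ρ qK ∧
        PilotKummerCompatHull ({ toSituation := situationPrVol X hlog M archPk archSub Ψ act Mmod region, col := col } :
            LatticeSituation (thetaIndex X))
          (settingPrVolSharp X hlog M archPk archSub Ψ act Mmod region n lat sig split qData tq t htq0 htq1) ρ qK := by
  refine exists_qPinned_and_hull_settingPrVolSharp_of_movers X hlog M archPk archSub Ψ act Mmod region n lat sig split qData tq t
    htq0 htq1 col fun pp j x => exists_mover_of_tame_level X hlog tq t pp j x ?_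
  haveI : Fact (pp : ℕ).Prime := ⟨pp.2⟩
  by_cases hj : 0 < (j : ℕ)
  · -- a label of `𝔽_l^⋇`: `labelIdele = t_{Θ,i}` with `i = j - 1`
    have hj' : j = labelSucc ⟨(j : ℕ) - 1, by have := j.2; simp only [thetaIndex] at this ⊢; omega⟩ := by
      ext; simp only [labelSucc, Fin.val_succ]; omega
    rw [hj', labelIdele_labelSucc]
    exact h pp _ x
  · -- the label `0`: `labelIdele = 1`
    left
    unfold labelIdele
    rw [dif_neg hj, norm_one]
    exact htqle pp x

/-! ## 3. c312-3's window: every bad place tame, `1 ≤ ord_x(t_{Θ,j}) ≤ e_x`, `ord_x(t_q) ≥ 1` -/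

/-- **THE LICENCE IN THE SHALLOW-RAMIFIED WINDOW** (abc-iut-c312-3's MATH NOTE, level `k = 0`): Θ-ideles units off `S` (e.g.
realising `P_Θ`), and at every place `x ∈ S`, `x | p`: `p > 2`, `e_x ≤ p − 2`, and for every label `j ∈ 𝔽_l^⋇`
`‖p‖·‖ϖ_x‖ < ‖t_{Θ,j,x}‖ ≤ ‖ϖ_x‖` and `‖t_{q,x}‖ ≤ ‖ϖ_x‖` — in orders `1 ≤ ord_x(t_{Θ,j}) ≤ e_x`, `ord_x(t_q) ≥ 1`; for ideles
realising `P_Θ = j²·P_q`: `j²·ord_x(t_q) ≤ e_x` at every bad `x` and `j ≤ l⋇` — THEN the (xi-f) licence holds at `settingDHVolSharp`.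
[cite: DupuyHilado2025, §3.9, §4.9] [cite: WeilBNT1967, Ch. II §2, Th. 1] [claim: Mochizuki2012, status: disputed] -/
theorem licence_settingDHVolSharp_of_shallow
    (ht1 : ∀ (pp : Nat.Primes) (i : Fin X.lstar) (x : (thetaIndex X).Fibre (.inr pp)),
      haveI : Fact (pp : ℕ).Prime := ⟨pp.2⟩; placeOf X pp.1 x ∉ X.S → ‖t pp i x‖ = 1)
    (hwin : ∀ (pp : Nat.Primes) (i : Fin (thetaIndex X).lstar) (x : (thetaIndex X).Fibre (.inr pp)),
      haveI : Fact (pp : ℕ).Prime := ⟨pp.2⟩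
      placeOf X pp.1 x ∈ X.S →
        2 < (pp : ℕ) ∧ (placeOf X pp.1 x).asIdeal.ramificationIdx ℤ ≤ (pp : ℕ) - 2 ∧
          ∃ ϖ : (kOf X pp.1 x)ˣ, IsUniformizer ϖ ∧
            ‖(pp : ℚ_[pp])‖ * ‖(ϖ : kOf X pp.1 x)‖ < ‖t pp i x‖ ∧ ‖t pp i x‖ ≤ ‖(ϖ : kOf X pp.1 x)‖ ∧
            ‖tq pp x‖ ≤ ‖(ϖ : kOf X pp.1 x)‖) :
    Thm311ToCor312.Licence (settingDHVolSharp X hlog M archPk archSub Ψ act Mmod region n lat sig split qData tq t htq0 htq1) := by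
  refine licence_settingDHVolSharp_of_tame_levels X hlog M archPk archSub Ψ act Mmod region n lat sig split qData tq t htq0 htq1
    fun pp i x => ?_
  haveI : Fact (pp : ℕ).Prime := ⟨pp.2⟩
  by_cases hx : placeOf X pp.1 x ∈ X.S
  · obtain ⟨hp2, he, ϖ, hϖ, h1, h2, h3⟩ := hwin pp i x hx
    exact Or.inr ⟨hp2, he, ϖ, 0, hϖ, by rwa [zpow_zero, one_mul], by rwa [zpow_zero, one_mul], by rwa [zpow_zero, one_mul]⟩
  · exact Or.inl (by rw [ht1 pp i x hx, htq1 pp x hx])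

/-- **The same at `settingPrVolSharp`.** [claim: Mochizuki2012, status: disputed] -/
theorem licence_settingPrVolSharp_of_shallow
    (ht1 : ∀ (pp : Nat.Primes) (i : Fin X.lstar) (x : (thetaIndex X).Fibre (.inr pp)),
      haveI : Fact (pp : ℕ).Prime := ⟨pp.2⟩; placeOf X pp.1 x ∉ X.S → ‖t pp i x‖ = 1)
    (hwin : ∀ (pp : Nat.Primes) (i : Fin (thetaIndex X).lstar) (x : (thetaIndex X).Fibre (.inr pp)),
      haveI : Fact (pp : ℕ).Prime := ⟨pp.2⟩
      placeOf X pp.1 x ∈ X.S →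
        2 < (pp : ℕ) ∧ (placeOf X pp.1 x).asIdeal.ramificationIdx ℤ ≤ (pp : ℕ) - 2 ∧
          ∃ ϖ : (kOf X pp.1 x)ˣ, IsUniformizer ϖ ∧
            ‖(pp : ℚ_[pp])‖ * ‖(ϖ : kOf X pp.1 x)‖ < ‖t pp i x‖ ∧ ‖t pp i x‖ ≤ ‖(ϖ : kOf X pp.1 x)‖ ∧
            ‖tq pp x‖ ≤ ‖(ϖ : kOf X pp.1 x)‖) :
    Thm311ToCor312.Licence (settingPrVolSharp X hlog M archPk archSub Ψ act Mmod region n lat sig split qData tq t htq0 htq1) := by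
  rw [licence_settingPrVolSharp_iff_settingDHVolSharp]
  exact licence_settingDHVolSharp_of_shallow X hlog M archPk archSub Ψ act Mmod region n lat sig split qData tq t htq0 htq1 ht1 hwin

/-- **Branch C's antecedent «∃ ρ qK, QPinned ∧ PilotKummerCompatHull» at `settingPrVolSharp` in the shallow-ramified window** (any
columns; q-ideles integral, automatic for ideles realising `P_q ≥ 0`). With C-cert-1's `thetaSide_of_exists_qPinned_and_hull_settingPrVolSharp`
this yields the typed Θ-side inequality at that setting. [cite: DupuyHilado2025, §3.9, §4.9] [claim: Mochizuki2012, status: disputed] -/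
theorem exists_qPinned_and_hull_settingPrVolSharp_of_shallow (htqle : ∀ pp x, ‖tq pp x‖ ≤ 1)
    (ht1 : ∀ (pp : Nat.Primes) (i : Fin X.lstar) (x : (thetaIndex X).Fibre (.inr pp)),
      haveI : Fact (pp : ℕ).Prime := ⟨pp.2⟩; placeOf X pp.1 x ∉ X.S → ‖t pp i x‖ = 1)
    (hwin : ∀ (pp : Nat.Primes) (i : Fin (thetaIndex X).lstar) (x : (thetaIndex X).Fibre (.inr pp)),
      haveI : Fact (pp : ℕ).Prime := ⟨pp.2⟩
      placeOf X pp.1 x ∈ X.S →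
        2 < (pp : ℕ) ∧ (placeOf X pp.1 x).asIdeal.ramificationIdx ℤ ≤ (pp : ℕ) - 2 ∧
          ∃ ϖ : (kOf X pp.1 x)ˣ, IsUniformizer ϖ ∧
            ‖(pp : ℚ_[pp])‖ * ‖(ϖ : kOf X pp.1 x)‖ < ‖t pp i x‖ ∧ ‖t pp i x‖ ≤ ‖(ϖ : kOf X pp.1 x)‖ ∧
            ‖tq pp x‖ ≤ ‖(ϖ : kOf X pp.1 x)‖) :
    ∃ (ρ : (∀ v : (thetaIndex X).V, v ∈ (thetaIndex X).Vbad → Set ((logShellsDH X logv).StarPacket v)) →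
          ∀ (j : (thetaIndex X).Label) (vQ : (thetaIndex X).VQ), Set ((logShellsDH X logv).Packet j vQ))
        (qK : ∀ v : (thetaIndex X).V, v ∈ (thetaIndex X).Vbad → Set ((logShellsDH X logv).StarPacket v)),
        QPinned ({ toSituation := situationPrVol X hlog M archPk archSub Ψ act Mmod region, col := col } :
            LatticeSituation (thetaIndex X))
          (settingPrVolSharp X hlog M archPk archSub Ψ act Mmod region n lat sig split qData tq t htq0 htq1) ρ qK ∧
        PilotKummerCompatHull ({ toSituation := situationPrVol X hlog M archPk archSub Ψ act Mmod region, col := col } :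
            LatticeSituation (thetaIndex X))
          (settingPrVolSharp X hlog M archPk archSub Ψ act Mmod region n lat sig split qData tq t htq0 htq1) ρ qK := by
  refine exists_qPinned_and_hull_settingPrVolSharp_of_tame_levels X hlog M archPk archSub Ψ act Mmod region n lat sig split qData
    tq t htq0 htq1 col htqle fun pp i x => ?_
  haveI : Fact (pp : ℕ).Prime := ⟨pp.2⟩
  by_cases hx : placeOf X pp.1 x ∈ X.S
  · obtain ⟨hp2, he, ϖ, hϖ, h1, h2, h3⟩ := hwin pp i x hx
    exact Or.inr ⟨hp2, he, ϖ, 0, hϖ, by rwa [zpow_zero, one_mul], by rwa [zpow_zero, one_mul], by rwa [zpow_zero, one_mul]⟩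
  · exact Or.inl (by rw [ht1 pp i x hx, htq1 pp x hx])

/-- **NON-VACUITY of the window at one factor** (the binders are satisfiable): at a tame place with `e_x ≥ 1` the element `ϖ`
itself lies in the level `0` (`‖p‖·‖ϖ‖ < ‖ϖ‖ ≤ ‖ϖ‖`), and `t_q := ϖ` satisfies `‖t_q‖ ≤ ‖ϖ‖`: the identity-free mover exists
(`g ϖ = ϖ`). [folklore] -/
theorem window_level_zero_self {K : Type} [NormedField K] {p : ℕ} [Fact p.Prime] [NormedAlgebra ℚ_[p] K] (ϖ : Kˣ) :
    ‖(p : ℚ_[p])‖ * ‖(ϖ : K)‖ < ‖(ϖ : K)‖ ∧ ‖(ϖ : K)‖ ≤ ‖(ϖ : K)‖ :=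
  ⟨mul_lt_of_lt_one_left (norm_pos_iff.2 ϖ.ne_zero) Padic.norm_p_lt_one, le_rfl⟩

end Setting

end Summit.ABC.IUTFork.Thm311.Real

end
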